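import Mathlib
import Summits.Ventures.PercRepro2.LocRows
import Summits.Ventures.PercRepro2.SwRow
import Summits.Ventures.PercRepro2.SwOut
import Summits.Ventures.PercRepro2.SwAllRow
import Summits.Ventures.PercRepro2.SwOutAll
import Summits.Ventures.PercRepro2.SwOutReducible
import Summits.Ventures.PercRepro2.SwOutJunctionH1Defs
import Summits.Ventures.PercRepro2.SwOutMixedPartDefs
import Summits.Ventures.PercRepro2.SwOutMixedPartClass
import Summits.Ventures.PercRepro2.SwOutMixedPartThm

/-!
# Row (SW) on every graph with a mixed single junction (blind cell PercRepro2, night-4 g19,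
2026-08-27; proofs/NIGHT4-G19.md §6)

Theorem A_mix (`rigidOK_of_mixedJunction`) with the h-piece connectivity supplied by a single
partner of `p` inside the region (`rigidOK_of_mixedJunction_unique`) makes every such region a
base region of the series reduction (`reducible_of_mixedJunction`); with the region `{l}ᶜ` this
is the rigid row 2′SW-ALL (`swAll_of_mixedJunction`) and row (SW) (`sw_of_mixedJunction`) on
every graph in which every vertex other than `l, h, o` is joined to `l` or is the junction `u`
or its dropped vertex `p` of a mixed single junction (`MixedJunction` in `U = V ∖ {l}`), `o`
outside the component of `p`, and `p` with a single partner inside `V ∖ {l}` — graphs on which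
the simple-arm hypothesis (H1) of Theorem A fails at `p`.
-/

namespace Summit.Ventures.PercRepro2

namespace BigBlock

open Hull LocRows

variable {V : Type*} {E : Type*} [Fintype E] [DecidableEq E]

open scoped Classical

variable {ends : E → Sym2 V} {U : Set V} {ξ : Config E} {l h o u p : V}

/-- Theorem A_mix with the h-piece connectivity from a single partner of `p`. -/
theorem rigidOK_of_mixedJunction_unique (hj : MixedJunction ends U h u p o) (hl : l ∉ U)
    (ho : o ∉ compU ends U h u p)
    (huniq : ∃ y₀, ∀ e x, ends e = s(p, x) → x ∈ U → x ≠ u → x = y₀) :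
    RigidOK ends l h o U ξ :=
  rigidOK_of_mixedJunction hj hl ho fun _ hζ hk => AhOf_conn_of_unique hj huniq hζ hk

/-- A region with a mixed single junction is a base region of the series reduction. -/
theorem reducible_of_mixedJunction (hj : MixedJunction ends U h u p o) (hl : l ∉ U)
    (ho : o ∉ compU ends U h u p)
    (huniq : ∃ y₀, ∀ e x, ends e = s(p, x) → x ∈ U → x ≠ u → x = y₀) :
    Reducible l h o ends U :=
  Reducible.base ends U fun ξ => rigidOK_of_mixedJunction_unique (ξ := ξ) hj hl ho huniq

/-- **Row 2′SW-ALL on every graph with a mixed single junction** in `{l}ᶜ`. -/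
theorem swAll_of_mixedJunction (hlh : l ≠ h) (hj : MixedJunction ends ({l}ᶜ) h u p o)
    (ho : o ∉ compU ends ({l}ᶜ) h u p)
    (huniq : ∃ y₀, ∀ e x, ends e = s(p, x) → x ∈ ({l}ᶜ : Set V) → x ≠ u → x = y₀) :
    SwAll ends l h o :=
  swAll_of_reducible l h o hlh (reducible_of_mixedJunction hj (by simp) ho huniq)

/-- **Row (SW) on every graph with a mixed single junction** (see `swAll_of_mixedJunction`). -/
theorem sw_of_mixedJunction (hlh : l ≠ h) (hj : MixedJunction ends ({l}ᶜ) h u p o)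
    (ho : o ∉ compU ends ({l}ᶜ) h u p)
    (huniq : ∃ y₀, ∀ e x, ends e = s(p, x) → x ∈ ({l}ᶜ : Set V) → x ≠ u → x = y₀) :
    Sw ends l h o :=
  sw_of_swAll ends (swAll_of_mixedJunction hlh hj ho huniq)

end BigBlock

end Summit.Ventures.PercRepro2
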